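import Summits.BirchSwinnertonDyer.BirchSwinnertonDyer.Theorems.QuadraticBranchSignedControlPlusEtaLowerInclusionPrimeCofactor
import Summits.BirchSwinnertonDyer.BirchSwinnertonDyer.Theorems.QuadraticBranchSignedControlPlusEtaLowerInclusionFunctionalEquationSqueezeTamagawaLocus
import HarnessLib

/-!
# Route `QuadraticBranchSignedControl` (rung K8, cell `bsd-potss`), crux `PlusEtaLowerInclusion`
# (item stmt-BirchSwinnertonDyer-19601): the PRIME-COFACTOR SQUEEZE, part 3 — IN STUB CURRENCY: the registered
# hardest stub `stub_etaLower_tamagawaRows` on the W-intrinsic analytic sub-locus «the Newton polygon of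
# `L_p⁺(V,η,T)/T^r` is ONE segment `(0, d−1)–(d, 0)`», modulo named facts, WITHOUT a functional equation
# (seat `bsd-potss-k8eta-c1` g12; `--supports` 19601)

WHAT. Part 2 (`…PrimeCofactor.lean`) proved the per-pair road; the sibling `…FunctionalEquationSqueezeTamagawaLocus`
(this seat) built the W-intrinsic Tamagawa place set. THIS FILE composes them exactly as the sibling's §3 did for the
functional-equation squeeze:
* §1 `etaPair_of_namedFacts_of_primeCofactor_of_tamagawaLevel` — abstract covering set `T ∌ 𝔭`, `ord_p c_w ≤ k` on `T`,
  `1 + k·r ≤ ∑_T ord_p c_w`, + the top-segment certificate of length `d ≥ 2` ⟹ (E⁺_η) ∧ (C1⁺_η);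
* §2 `stub_etaLower_tamagawaRows_rankZero_of_namedFacts_of_topSegment` — the binders of
  `Sig.stub_etaLower_tamagawaRows` VERBATIM (… `p ∣ ∏ c_ℓ(W)`) + `rank W(ℚ) = 0` + the `V`-certificate + the
  top-segment certificate ⟹ the stub's conclusion, GRANTED {Kobayashi 1.2/1.3/2.2η/4.1η, Kitajima–Otsuki 1.3η,
  Poitou–Tate} — one named fact FEWER than the sibling (no B. D. Kim 3.11η);
  `tamagawaRows_rankOne_of_namedFacts_of_topSegment` — rank `1`, two split Tamagawa-`p` primes.
READING (numbers): with `d = 2`, `m = d − 1 = 1` the top segment is the Eisenstein shape `p ∥ coeff_r`, i.e. `v_an = 1`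
— the valuation squeeze's own one-factor case (13 r1 two-prime census rows); with `d = 4`, `m = 3` it is the census row
`288600bn1` (part 2's record). The sibling's `λ ≤ r + 2` sub-locus and this one overlap exactly in the Eisenstein
quadratics; irreducible NON-Eisenstein quadratics (`v_an ≥ 2`, e.g. the Tamagawa-free r0 rows `39675m1`, `80550g1`)
are the sibling's, split quadratics (`69150v1`, `137775i1`) are the sibling's, top segments of length `≥ 3` are this
file's. NO census number moves (40/40); closes NONE; books nothing.

HONEST FRAMING (cell `bsd-potss`, run/shared/lean/pub/bsd-potss/; FULL-BSD rank ≤ 1 programme, HUMAN RULING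
D-0036/D-0074): TOOL THEOREMS, CONDITIONAL on the named Literature facts in hypothesis position and on displayed
per-pair inputs (`rank W(ℚ)`; on the twist: tower onto, the `V`-certificate, the analytic top-segment shape).
Crux 19601 is OPEN class-wide and NOT closed; nothing is booked; `BSD(W, p)` is claimed for no pair. No definition,
no named fact, no `sorry`, axioms standard.

References: [Kobayashi2003] Thm. 2.2 (p. 5), §4 + Thm. 4.1 (p. 8), Thm. 9.3; [KitajimaOtsuki2018] Thm. 1.3;
[MilneADT2006] I Thm. 4.10; [Washington1997] §7.1, §13.2; [SilvermanATAEC1994] Cor. IV.9.2 (b),(d).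
-/

set_option autoImplicit false
set_option linter.dupNamespace false

noncomputable section

open scoped Classical AddSubgroup NumberField

open CongruenceSubgroup Field NumberField IsDedekindDomain WeierstrassCurve Rat.HeightOneSpectrum
open Literature.NumberTheory.EllipticCurves
open Literature.NumberTheory.EllipticCurves.ModularForms
open Literature.NumberTheory.GaloisRepresentations
open Literature.NumberTheory.GaloisCohomology
open Literature.NumberTheory.EllipticCurves.IwasawaDual
open Literature.NumberTheory.EllipticCurves.IwasawaAlgebra
open Summit.BirchSwinnertonDyer.Rank1Residual.Additive
open Summit.BirchSwinnertonDyer.BirchSwinnertonDyer.Rank2Observatory.Tam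
open Summit.BirchSwinnertonDyer.Rank1Residual

namespace Summit.BirchSwinnertonDyer.BirchSwinnertonDyer.Theorems

/-! ## §1 Abstract covering set of Tamagawa places -/

section Pair

variable {V : WeierstrassCurve ℚ} [V.IsElliptic] [V.IsGloballyMinimal] {p : ℕ} [hp : Fact p.Prime]

/-- **(E⁺_η) ∧ (C1⁺_η) at a tower-onto pair from a top-segment cofactor and the Tamagawa numbers of the partner —
abstract form, NO functional equation.** GRANTED Kobayashi 1.2/1.3/2.2η/4.1η, Kitajima–Otsuki 1.3η and Poitou–Tate
(NAMED facts): on a good `a_p = 0` pair with `p ≥ 5`, `ρ_{V,p^m}` onto, the `V`-certificate and the analytic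
top-segment certificate of length `d ≥ 2` (`r = rank V^{(p*)}(ℚ)`), for a globally minimal partner `W`
(`C • W^{(p*)} = V`) and ANY finite set `T` of finite places with `𝔭 ∉ T`, every `v ≠ 𝔭` with `p ∣ c_v(W)` in `T`,
`ord_p c_w(W) ≤ k` on `T` (`k ≥ 1`) and `1 + k·r ≤ ∑_{w ∈ T} ord_p c_w(W)`: (E⁺_η)(V,p) ∧ (C1⁺_η)(V,p) (gen 4's
level-`p^k` Tamagawa road at `v = 1` feeds part 2's road). CONDITIONAL; closes nothing class-wide.
[cite: Kobayashi2003, Thm. 2.2 (p. 5), §4 and Thm. 4.1 (p. 8), Thm. 9.3] [cite: KitajimaOtsuki2018, Thm. 1.3]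
[cite: MilneADT2006, Ch. I, Thm. 4.10] [cite: Washington1997, §7.1 Thm. 7.3] -/
theorem etaPair_of_namedFacts_of_primeCofactor_of_tamagawaLevel
    (h12 : Kobayashi2003.thm12_signedSelmerDual_finite_torsion)
    (h13 : Kobayashi2003.thm41_signedCharIdeal_divisibility)
    (h22 : Kobayashi2003.thm22_etaSignedSelmerDual_finite_torsion)
    (h41 : Kobayashi2003.thm41_plusEtaCharIdeal_dvd)
    (hKO : KitajimaOtsuki2018.mainThm13_etaSignedSelmerDual_noFiniteSubmodule)
    (hPT : poitouTate_selmerStructure_duality_real ℚ)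
    (hp5 : 5 ≤ p) (hgood : V.HasGoodReductionAtPrime p) (hap : V.frobeniusTrace p = 0)
    (hsurj : ∀ m : ℕ, V.HasSurjectiveModNGaloisRep (p ^ m : ℕ))
    (hcertV : ∀ {N : ℕ} [NeZero N] (f : CuspForm (Gamma0 N) 2), IsNewformOf V f →
      ∃ L : IwasawaAlgebra p, Kobayashi2003.IsSignedPAdicLFunction f p 1 L ∧
        IsUnit (PowerSeries.coeff V.mordellWeilRank L))
    (d : ℕ) (hd2 : 2 ≤ d)
    (hanNP : ∀ {N : ℕ} [NeZero N] {f : CuspForm (Gamma0 N) 2}, IsNewformOf V f →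
      ∀ (ϖ : ℚ), (if Even (p / 2) then (ϖ : ℝ) * V.realPeriodRat = plusPeriod f
          else (ϖ : ℝ) * V.imaginaryPeriodRat = minusPeriod f) →
      ∀ (Lη : IwasawaAlgebra p), IsQuadraticBranchPlusLFunction f p ϖ Lη →
        (p : ℤ_[p]) ^ (d - 1) ∣ PowerSeries.coeff (V.quadraticTwist ((-1) ^ (p / 2) * p)).mordellWeilRank Lη ∧
        ¬ (p : ℤ_[p]) ^ d ∣ PowerSeries.coeff (V.quadraticTwist ((-1) ^ (p / 2) * p)).mordellWeilRank Lη ∧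
        (∀ i, 0 < i → i < d → (p : ℤ_[p]) ^ (d - i) ∣
          PowerSeries.coeff ((V.quadraticTwist ((-1) ^ (p / 2) * p)).mordellWeilRank + i) Lη) ∧
        ¬ (p : ℤ_[p]) ∣ PowerSeries.coeff ((V.quadraticTwist ((-1) ^ (p / 2) * p)).mordellWeilRank + d) Lη)
    (W : WeierstrassCurve ℚ) [W.IsElliptic] [W.IsGloballyMinimal] (C : VariableChange ℚ)
    (hCV : C • W.quadraticTwist ((-1) ^ (p / 2) * p) = V)
    (T : Finset (HeightOneSpectrum (𝓞 ℚ)))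
    (hpT : (Rat.HeightOneSpectrum.primesEquiv (R := 𝓞 ℚ)).symm ⟨p, hp.out⟩ ∉ T)
    (hT : ∀ v : HeightOneSpectrum (𝓞 ℚ), v ≠ (Rat.HeightOneSpectrum.primesEquiv (R := 𝓞 ℚ)).symm ⟨p, hp.out⟩ →
      p ∣ (W.baseChange (v.adicCompletion ℚ)).localTamagawaNumber (v.adicCompletionIntegers ℚ) → v ∈ T)
    (k : ℕ) (hk : 1 ≤ k)
    (hTk : ∀ w ∈ T, padicValNat p ((W.baseChange (w.adicCompletion ℚ)).localTamagawaNumber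
      (w.adicCompletionIntegers ℚ)) ≤ k)
    (hsum : 1 + k * (V.quadraticTwist ((-1) ^ (p / 2) * p)).mordellWeilRank ≤
      ∑ w ∈ T, padicValNat p ((W.baseChange (w.adicCompletion ℚ)).localTamagawaNumber
        (w.adicCompletionIntegers ℚ))) :
    QuadraticBranchPlusEtaLowerInclusionAt V p ∧ QuadraticBranchPlusEtaMainConjectureAt V p := by
  refine quadraticBranchPlusEta_pair_of_namedFacts_of_primeCofactor_of_torsionDvd h12 h13 h22 h41 hKO hp5 hgood
    hap hsurj (fun f hf => hcertV f hf) d hd2 (fun hf => hanNP hf) ?_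
  intro K₀ _ _ _ _ ηq hηK hη1 κ γ hκ hγ hγK hγc N _ f hf ϖ hϖ Lη hL hne D
  have h := pow_dvd_natCard_torsion_coinvariants_of_namedFacts_of_poitouTate_of_tamagawa_level h12 h13
    h22 h41 hPT hp5 hgood hap hsurj (fun f hf => hcertV f hf) hf ϖ hϖ Lη hL hne W C hCV T hpT hT k hk hTk
    K₀ ηq hηK hη1 κ γ hκ hγ hγK hγc D 1 hsum
  rwa [pow_one] at h

end Pair

/-! ## §2 The stub's top-segment sub-loci (class-wide form) -/

section Stub

/-- **THE HARDEST STUB ON THE RANK-ZERO TOP-SEGMENT SUB-LOCUS, IN THE STUB'S OWN CURRENCY, NO FUNCTIONAL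
EQUATION.** GRANTED {Kobayashi 1.2/1.3/2.2η/4.1η, Kitajima–Otsuki 1.3η, Poitou–Tate}: the binders of
`Sig.stub_etaLower_tamagawaRows` VERBATIM (`V`, `W`, `C`, `p`, `5 ≤ p`, `C • W^{(p*)} = V`, good, `a_p(V) = 0`,
tower onto, `p ∣ ∏ c_ℓ(W)`) followed by `rank W(ℚ) = 0` (DISPLAYED), the `V`-certificate and the analytic
TOP-SEGMENT certificate of length `d ≥ 2` on `L_p⁺(V,η,T)` (`p^{d−1} ∥ coeff₀`, `p^{d−i} ∣ coeff_i` for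
`0 < i < d`, `p ∤ coeff_d`) give (E⁺_η)(V,p) ∧ (C1⁺_η)(V,p). No `L(W,1)`, no `#Ш_an`, no Kurihara number, no row
certificate, no functional equation. CONDITIONAL; a SUB-LOCUS of the registered stub (which stays OPEN class-wide);
closes nothing by itself; nothing booked; `BSD(W,p)` claimed for no pair.
[cite: Kobayashi2003, Thm. 2.2 (p. 5), §4 Even main conjecture and Thm. 4.1 (p. 8), Thm. 9.3]
[cite: KitajimaOtsuki2018, Thm. 1.3] [cite: MilneADT2006, Ch. I, Thm. 4.10] [cite: SilvermanATAEC1994, Cor. IV.9.2 (d)] -/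
theorem stub_etaLower_tamagawaRows_rankZero_of_namedFacts_of_topSegment
    (h12 : Kobayashi2003.thm12_signedSelmerDual_finite_torsion)
    (h13 : Kobayashi2003.thm41_signedCharIdeal_divisibility)
    (h22 : Kobayashi2003.thm22_etaSignedSelmerDual_finite_torsion)
    (h41 : Kobayashi2003.thm41_plusEtaCharIdeal_dvd)
    (hKO : KitajimaOtsuki2018.mainThm13_etaSignedSelmerDual_noFiniteSubmodule)
    (hPT : poitouTate_selmerStructure_duality_real ℚ)
    (V : WeierstrassCurve ℚ) [V.IsElliptic] [V.IsGloballyMinimal] (W : WeierstrassCurve ℚ)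
    [W.IsElliptic] [W.IsGloballyMinimal] (C : VariableChange ℚ) (p : ℕ) [hp : Fact p.Prime]
    (hp5 : 5 ≤ p) (hCV : C • W.quadraticTwist ((-1) ^ (p / 2) * p) = V)
    (hgood : V.HasGoodReductionAtPrime p) (hap : V.frobeniusTrace p = 0)
    (hsurj : ∀ m : ℕ, V.HasSurjectiveModNGaloisRep (p ^ m : ℕ)) (htam : p ∣ W.tamagawaProduct)
    (hr0 : W.mordellWeilRank = 0)
    (hcertV : ∀ {N : ℕ} [NeZero N] (f : CuspForm (Gamma0 N) 2), IsNewformOf V f →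
      ∃ L : IwasawaAlgebra p, Kobayashi2003.IsSignedPAdicLFunction f p 1 L ∧
        IsUnit (PowerSeries.coeff V.mordellWeilRank L))
    (d : ℕ) (hd2 : 2 ≤ d)
    (hanNP : ∀ {N : ℕ} [NeZero N] {f : CuspForm (Gamma0 N) 2}, IsNewformOf V f →
      ∀ (ϖ : ℚ), (if Even (p / 2) then (ϖ : ℝ) * V.realPeriodRat = plusPeriod f
          else (ϖ : ℝ) * V.imaginaryPeriodRat = minusPeriod f) →
      ∀ (Lη : IwasawaAlgebra p), IsQuadraticBranchPlusLFunction f p ϖ Lη →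
        (p : ℤ_[p]) ^ (d - 1) ∣ PowerSeries.coeff 0 Lη ∧ ¬ (p : ℤ_[p]) ^ d ∣ PowerSeries.coeff 0 Lη ∧
        (∀ i, 0 < i → i < d → (p : ℤ_[p]) ^ (d - i) ∣ PowerSeries.coeff i Lη) ∧
        ¬ (p : ℤ_[p]) ∣ PowerSeries.coeff d Lη) :
    QuadraticBranchPlusEtaLowerInclusionAt V p ∧ QuadraticBranchPlusEtaMainConjectureAt V p := by
  obtain ⟨ℓ, hℓ, hs, hd⟩ := (X11b.dvd_tamagawaProduct_iff_exists_split W hp.out hp5).mp htam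
  have hℓp : ℓ ≠ p := ne_of_split_of_smul_quadraticTwist_eq hp5 hCV hgood hs
  obtain ⟨T, hpT, hT, -⟩ := exists_tamagawaFinset W p
  have hd0 : ((-1 : ℚ) ^ (p / 2) * p) ≠ 0 :=
    mul_ne_zero (pow_ne_zero _ (by norm_num)) (Nat.cast_ne_zero.mpr hp.out.ne_zero)
  have hrk : (V.quadraticTwist ((-1) ^ (p / 2) * p)).mordellWeilRank = 0 := by
    rw [TamagawaRoad.mordellWeilRank_quadraticTwist_eq_of_smul_quadraticTwist_eq hd0 hCV, hr0]
  have hmem : pl ℓ ∈ T :=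
    hT (pl ℓ) (pl_ne_of_ne p hℓ.out hℓp) (dvd_localTamagawaNumber_pl_of_split W p hs hd)
  have hle : ∀ w ∈ T, padicValNat p ((W.baseChange (w.adicCompletion ℚ)).localTamagawaNumber
      (w.adicCompletionIntegers ℚ)) ≤ ∑ w ∈ T, padicValNat p ((W.baseChange (w.adicCompletion ℚ)).localTamagawaNumber
        (w.adicCompletionIntegers ℚ)) :=
    fun w hw => TamagawaLocus.le_sum_of_mem T
      (fun x => padicValNat p ((W.baseChange (x.adicCompletion ℚ)).localTamagawaNumber (x.adicCompletionIntegers ℚ))) hw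
  have h1 : 1 ≤ ∑ w ∈ T, padicValNat p ((W.baseChange (w.adicCompletion ℚ)).localTamagawaNumber
      (w.adicCompletionIntegers ℚ)) :=
    (one_le_padicValNat_localTamagawaNumber_pl_of_split W p hs hd).trans (hle _ hmem)
  refine etaPair_of_namedFacts_of_primeCofactor_of_tamagawaLevel h12 h13 h22 h41 hKO hPT hp5 hgood hap hsurj
    (fun f hf => hcertV f hf) d hd2 ?_ W C hCV T hpT hT _ h1 hle ?_
  · intro N _ f hf ϖ hϖ Lη hL
    rw [hrk]
    simpa only [zero_add] using hanNP hf ϖ hϖ Lη hL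
  · rw [hrk, mul_zero, add_zero]
    exact h1

/-- **THE HARDEST STUB ON THE RANK-ONE TWO-PRIME TOP-SEGMENT SUB-LOCUS, NO FUNCTIONAL EQUATION.** Same named
facts and binders, with the Tamagawa rows named by TWO distinct split multiplicative primes `ℓ₁ ≠ ℓ₂` of `W` with
`p ∣ ord_{ℓ_i} Δ_min(W)`, IF `rank W(ℚ) = 1` (DISPLAYED) and the twist carries the `V`-certificate and the
top-segment certificate of length `d ≥ 2` starting at `coeff₁` (`p^{d−1} ∥ coeff₁`, `p^{d−i} ∣ coeff_{1+i}`,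
`p ∤ coeff_{1+d}`), THEN (E⁺_η)(V,p) ∧ (C1⁺_η)(V,p) (`ℓ_i ≠ p` automatically; level `k = S − 1`,
`S = ∑_T ord_p c_w ≥ 2`). CONDITIONAL; a sub-locus of an OPEN class-wide statement; closes nothing by itself;
nothing booked; `BSD(W,p)` claimed for no pair.
[cite: Kobayashi2003, Thm. 2.2 (p. 5), §4 and Thm. 4.1 (p. 8), Thm. 9.3] [cite: KitajimaOtsuki2018, Thm. 1.3]
[cite: MilneADT2006, Ch. I, Thm. 4.10] [cite: SilvermanATAEC1994, Cor. IV.9.2 (d)] -/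
theorem tamagawaRows_rankOne_of_namedFacts_of_topSegment
    (h12 : Kobayashi2003.thm12_signedSelmerDual_finite_torsion)
    (h13 : Kobayashi2003.thm41_signedCharIdeal_divisibility)
    (h22 : Kobayashi2003.thm22_etaSignedSelmerDual_finite_torsion)
    (h41 : Kobayashi2003.thm41_plusEtaCharIdeal_dvd)
    (hKO : KitajimaOtsuki2018.mainThm13_etaSignedSelmerDual_noFiniteSubmodule)
    (hPT : poitouTate_selmerStructure_duality_real ℚ)
    (V : WeierstrassCurve ℚ) [V.IsElliptic] [V.IsGloballyMinimal] (W : WeierstrassCurve ℚ)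
    [W.IsElliptic] [W.IsGloballyMinimal] (C : VariableChange ℚ) (p : ℕ) [hp : Fact p.Prime]
    (hp5 : 5 ≤ p) (hCV : C • W.quadraticTwist ((-1) ^ (p / 2) * p) = V)
    (hgood : V.HasGoodReductionAtPrime p) (hap : V.frobeniusTrace p = 0)
    (hsurj : ∀ m : ℕ, V.HasSurjectiveModNGaloisRep (p ^ m : ℕ))
    {ℓ₁ ℓ₂ : ℕ} [hℓ₁ : Fact ℓ₁.Prime] [hℓ₂ : Fact ℓ₂.Prime] (hℓ₁₂ : ℓ₁ ≠ ℓ₂)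
    (hs₁ : W.HasSplitMultiplicativeReductionAtPrime ℓ₁) (hs₂ : W.HasSplitMultiplicativeReductionAtPrime ℓ₂)
    (hd₁ : p ∣ padicValInt ℓ₁ W.minimalDiscriminantInt) (hd₂ : p ∣ padicValInt ℓ₂ W.minimalDiscriminantInt)
    (hr1 : W.mordellWeilRank = 1)
    (hcertV : ∀ {N : ℕ} [NeZero N] (f : CuspForm (Gamma0 N) 2), IsNewformOf V f →
      ∃ L : IwasawaAlgebra p, Kobayashi2003.IsSignedPAdicLFunction f p 1 L ∧
        IsUnit (PowerSeries.coeff V.mordellWeilRank L))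
    (d : ℕ) (hd2 : 2 ≤ d)
    (hanNP : ∀ {N : ℕ} [NeZero N] {f : CuspForm (Gamma0 N) 2}, IsNewformOf V f →
      ∀ (ϖ : ℚ), (if Even (p / 2) then (ϖ : ℝ) * V.realPeriodRat = plusPeriod f
          else (ϖ : ℝ) * V.imaginaryPeriodRat = minusPeriod f) →
      ∀ (Lη : IwasawaAlgebra p), IsQuadraticBranchPlusLFunction f p ϖ Lη →
        (p : ℤ_[p]) ^ (d - 1) ∣ PowerSeries.coeff 1 Lη ∧ ¬ (p : ℤ_[p]) ^ d ∣ PowerSeries.coeff 1 Lη ∧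
        (∀ i, 0 < i → i < d → (p : ℤ_[p]) ^ (d - i) ∣ PowerSeries.coeff (1 + i) Lη) ∧
        ¬ (p : ℤ_[p]) ∣ PowerSeries.coeff (1 + d) Lη) :
    QuadraticBranchPlusEtaLowerInclusionAt V p ∧ QuadraticBranchPlusEtaMainConjectureAt V p := by
  obtain ⟨T, hpT, hT, -⟩ := exists_tamagawaFinset W p
  have hd0 : ((-1 : ℚ) ^ (p / 2) * p) ≠ 0 :=
    mul_ne_zero (pow_ne_zero _ (by norm_num)) (Nat.cast_ne_zero.mpr hp.out.ne_zero)
  have hrk : (V.quadraticTwist ((-1) ^ (p / 2) * p)).mordellWeilRank = 1 := by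
    rw [TamagawaRoad.mordellWeilRank_quadraticTwist_eq_of_smul_quadraticTwist_eq hd0 hCV, hr1]
  have hmem₁ : pl ℓ₁ ∈ T := hT (pl ℓ₁) (pl_ne_of_ne p hℓ₁.out (ne_of_split_of_smul_quadraticTwist_eq hp5 hCV hgood hs₁))
    (dvd_localTamagawaNumber_pl_of_split W p hs₁ hd₁)
  have hmem₂ : pl ℓ₂ ∈ T := hT (pl ℓ₂) (pl_ne_of_ne p hℓ₂.out (ne_of_split_of_smul_quadraticTwist_eq hp5 hCV hgood hs₂))
    (dvd_localTamagawaNumber_pl_of_split W p hs₂ hd₂)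
  have hne : pl ℓ₁ ≠ pl ℓ₂ := fun h => hℓ₁₂ (by
    have h1 := natGenerator_pl hℓ₁.out
    rw [h, natGenerator_pl hℓ₂.out] at h1
    exact h1.symm)
  have hc₁ := one_le_padicValNat_localTamagawaNumber_pl_of_split W p hs₁ hd₁
  have hc₂ := one_le_padicValNat_localTamagawaNumber_pl_of_split W p hs₂ hd₂
  have hrest : ∀ w ∈ T, padicValNat p ((W.baseChange (w.adicCompletion ℚ)).localTamagawaNumber
      (w.adicCompletionIntegers ℚ)) + 1 ≤ ∑ w ∈ T, padicValNat p ((W.baseChange (w.adicCompletion ℚ)).localTamagawaNumber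
        (w.adicCompletionIntegers ℚ)) := by
    intro w hw
    rw [← Finset.add_sum_erase T _ hw]
    refine Nat.add_le_add_left ?_ _
    by_cases hw₁ : w = pl ℓ₁
    · have hm : pl ℓ₂ ∈ T.erase w := Finset.mem_erase.mpr ⟨fun h => hne (hw₁ ▸ h.symm), hmem₂⟩
      exact hc₂.trans (TamagawaLocus.le_sum_of_mem (T.erase w)
        (fun x => padicValNat p ((W.baseChange (x.adicCompletion ℚ)).localTamagawaNumber (x.adicCompletionIntegers ℚ))) hm)
    · have hm : pl ℓ₁ ∈ T.erase w := Finset.mem_erase.mpr ⟨fun h => hw₁ h.symm, hmem₁⟩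
      exact hc₁.trans (TamagawaLocus.le_sum_of_mem (T.erase w)
        (fun x => padicValNat p ((W.baseChange (x.adicCompletion ℚ)).localTamagawaNumber (x.adicCompletionIntegers ℚ))) hm)
  have h2 : 2 ≤ ∑ w ∈ T, padicValNat p ((W.baseChange (w.adicCompletion ℚ)).localTamagawaNumber
      (w.adicCompletionIntegers ℚ)) := by
    have := hrest _ hmem₁
    omega
  refine etaPair_of_namedFacts_of_primeCofactor_of_tamagawaLevel h12 h13 h22 h41 hKO hPT hp5 hgood hap hsurj
    (fun f hf => hcertV f hf) d hd2 ?_ W C hCV T hpT hT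
    (∑ w ∈ T, padicValNat p ((W.baseChange (w.adicCompletion ℚ)).localTamagawaNumber
      (w.adicCompletionIntegers ℚ)) - 1) (by omega)
    (fun w hw => by have := hrest w hw; omega) ?_
  · intro N _ f hf ϖ hϖ Lη hL
    rw [hrk]
    exact hanNP hf ϖ hϖ Lη hL
  · rw [hrk, mul_one]
    omega

end Stub

end Summit.BirchSwinnertonDyer.BirchSwinnertonDyer.Theorems

end
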